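import Mathlib
import HarnessLib

/-!
# Route `AlmostPrimeZeros`, crux `SystemMomentDeficit` (stmt-Parity-11326), line `Sketch`
# (idea `small-circle-jensen`): Jensen at the free centre ⇒ zero-free disc (`stub_zeroFree`)

Pure complex analysis over an arbitrary `P ∈ ℂ[z]` with `P(1) ≠ 0`.  For a real tilt `a` put
`H(z) = P(z) e^{−a(z−1)} / P(1)`; this is an entire function with `H(1) = 1` whose zeros are
exactly the roots of `P`, with the same multiplicities (the exponential never vanishes).  We prove:
if the angular mean of `log⁺ ‖H‖` over the circle `‖z − 1‖ = r` (`r > 0`) is at most `A`, then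
`P` has no zero in the open disc `‖z − 1‖ < r e^{−A}`.

Proof.  Jensen's formula for `H` on `‖z − 1‖ = r` (Mathlib `AnalyticOnNhd.circleAverage_log_norm`;
the divisor of `H` is the root multiplicity of `P`) reads, in multiset form,
`Σ_{ρ ∈ roots P} log⁺(r/‖1−ρ‖) = ⨍ log ‖H‖` (the constant term `log ‖H(1)‖` vanishes).  Since
`log ≤ log⁺` pointwise and both `log ‖H‖`, `log⁺ ‖H‖` are circle integrable (meromorphic
integrands), monotonicity of circle averages gives `Σ_ρ log⁺(r/‖1−ρ‖) ≤ ⨍ log⁺ ‖H‖ ≤ A`; every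
term is `≥ 0`, so a single root `ρ` (necessarily `ρ ≠ 1`) has `log(r/‖1−ρ‖) ≤ A`, i.e.
`‖ρ − 1‖ ≥ r e^{−A}`.

References: the line card `Cruxes/SystemMomentDeficit/Lines/Sketch`; the sibling tree file
`Theorems/AlmostPrimeZerosLinearCappedRepulsionJensenCount.lean` (pattern source for the multiset
form of Jensen's formula); E. C. Titchmarsh, *The Theory of Functions*, 2nd ed., §3.61.
-/

noncomputable section

open Complex Set MeasureTheory Filter Topology Metric Polynomial Real

namespace Summit.Parity.BatemanHorn.Cruxes.SystemMomentDeficit.SmallCircle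

/-- For a non-zero complex polynomial `P` and `a ∈ ℂ`, the order of vanishing of `z ↦ P(z)` at
`a` is the root multiplicity `mult_a(P)`: write `P = (X - a)^m Q` with `Q(a) ≠ 0`. [folklore] -/
private theorem analyticOrderAt_eval_eq_rootMultiplicity {P : ℂ[X]} (hP : P ≠ 0) (a : ℂ) :
    analyticOrderAt (fun z => P.eval z) a = P.rootMultiplicity a := by
  -- adapted from Theorems/AlmostPrimeZerosLinearCappedRepulsionJensenCount.lean
  set m := P.rootMultiplicity a with hm
  set Q := P /ₘ (X - C a) ^ m with hQ
  have hdec : (X - C a) ^ m * Q = P := P.pow_mul_divByMonic_rootMultiplicity_eq a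
  have hQa : Q.eval a ≠ 0 := eval_divByMonic_pow_rootMultiplicity_ne_zero a hP
  have hfun : (fun z => P.eval z) = ((· - a) ^ m) * fun z => Q.eval z := by
    funext z
    conv_lhs => rw [← hdec]
    simp [eval_pow]
  have h1 : AnalyticAt ℂ ((· - a) ^ m) a := by fun_prop
  have h2 : AnalyticAt ℂ (fun z => Q.eval z) a := Q.differentiable.analyticAt a
  rw [hfun, analyticOrderAt_mul h1 h2, analyticOrderAt_centeredMonomial,
    h2.analyticOrderAt_eq_zero.mpr hQa, add_zero]

/-- For `P ∈ ℂ[z]` with `P(1) ≠ 0` and a real tilt `a`, the entire function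
`H(z) = P(z) e^{−a(z−1)} / P(1)` has the same order of vanishing as `P` at every point `u`, namely
the root multiplicity `mult_u(P)`: the factor `e^{−a(z−1)}/P(1)` is analytic and never vanishes.
[folklore] -/
private theorem analyticOrderAt_tilt_eq_rootMultiplicity {P : ℂ[X]} (hP1 : P.eval 1 ≠ 0) (a : ℝ)
    (u : ℂ) :
    analyticOrderAt (fun z : ℂ => P.eval z * Complex.exp (-((a : ℂ) * (z - 1))) / P.eval 1) u =
      P.rootMultiplicity u := by
  have hP : P ≠ 0 := fun h => hP1 (by simp [h])
  have hfun : (fun z : ℂ => P.eval z * Complex.exp (-((a : ℂ) * (z - 1))) / P.eval 1) =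
      (fun z => P.eval z) * fun z => Complex.exp (-((a : ℂ) * (z - 1))) / P.eval 1 := by
    funext z
    simp only [Pi.mul_apply]
    ring
  have hf : AnalyticAt ℂ (fun z => P.eval z) u := P.differentiable.analyticAt u
  have hgd : Differentiable ℂ fun z : ℂ => Complex.exp (-((a : ℂ) * (z - 1))) / P.eval 1 := by
    fun_prop
  have hg : AnalyticAt ℂ (fun z : ℂ => Complex.exp (-((a : ℂ) * (z - 1))) / P.eval 1) u :=
    hgd.analyticAt u
  have hgu : Complex.exp (-((a : ℂ) * (u - 1))) / P.eval 1 ≠ 0 :=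
    div_ne_zero (Complex.exp_ne_zero _) hP1
  rw [hfun, analyticOrderAt_mul hf hg, hg.analyticOrderAt_eq_zero.mpr hgu, add_zero,
    analyticOrderAt_eval_eq_rootMultiplicity hP u]

/-- **Jensen's formula at the free centre, multiset form.**  Let `P ∈ ℂ[z]` with `P(1) ≠ 0` and
let `H` be an entire function with `H(1) = 1` whose order of vanishing at every point `u` is the
root multiplicity `mult_u(P)`.  Then for `R > 0`,
`circleAverage (log ‖H‖) 1 R = Σ_{ρ ∈ roots P} log⁺ (R/‖1 − ρ‖)`, the sum over the roots with
multiplicity (Mathlib's Jensen formula `AnalyticOnNhd.circleAverage_log_norm`, with the divisor of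
`H` identified as the root multiplicity of `P`, and `log ‖H(1)‖ = 0`). [folklore] -/
private theorem circleAverage_log_norm_of_order {P : ℂ[X]} (hP1 : P.eval 1 ≠ 0) {H : ℂ → ℂ}
    (hHd : Differentiable ℂ H) (hord : ∀ u : ℂ, analyticOrderAt H u = P.rootMultiplicity u)
    (hH1 : H 1 = 1) {R : ℝ} (hR : 0 < R) :
    Real.circleAverage (fun z => Real.log ‖H z‖) 1 R =
      (P.roots.map fun ρ => Real.posLog (R * ‖1 - ρ‖⁻¹)).sum := by
  -- adapted from `circleAverage_log_norm_eval` in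
  -- Theorems/AlmostPrimeZerosLinearCappedRepulsionJensenCount.lean
  classical
  have hP : P ≠ 0 := fun h => hP1 (by simp [h])
  have hfan : AnalyticOnNhd ℂ H (closedBall (1 : ℂ) |R|) := fun z _ => hHd.analyticAt z
  have h1 : H 1 ≠ 0 := by rw [hH1]; exact one_ne_zero
  have hJ := hfan.circleAverage_log_norm hR.ne' h1
  rw [hJ, hH1, norm_one, Real.log_one, add_zero]
  have habs : |R| = R := abs_of_pos hR
  set D := MeromorphicOn.divisor H (closedBall (1 : ℂ) |R|) with hD
  have hDin : ∀ u : ℂ, ‖1 - u‖ ≤ R → D u = P.rootMultiplicity u := by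
    intro u hu
    have hmem : u ∈ closedBall (1 : ℂ) |R| := by
      rw [mem_closedBall, dist_eq_norm, norm_sub_rev, habs]; exact hu
    rw [hD, MeromorphicOn.AnalyticOnNhd.divisor_apply hfan hmem, hord u]
    simp
  have hDout : ∀ u : ℂ, ¬ ‖1 - u‖ ≤ R → D u = 0 := by
    intro u hu
    apply Function.locallyFinsuppWithin.apply_eq_zero_of_notMem
    rw [mem_closedBall, dist_eq_norm, norm_sub_rev, habs]; exact hu
  have hsupp : Function.support (fun u => (D u : ℝ) * Real.log (R * ‖1 - u‖⁻¹)) ⊆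
      ↑P.roots.toFinset := by
    intro u hu
    rw [Function.mem_support] at hu
    have hDu : D u ≠ 0 := fun h => hu (by simp [h])
    have hin : ‖1 - u‖ ≤ R := by_contra fun h => hDu (hDout u h)
    rw [hDin u hin] at hDu
    have hroot : IsRoot P u :=
      (rootMultiplicity_pos hP).1 (Nat.pos_of_ne_zero (by exact_mod_cast hDu))
    simpa [Multiset.mem_toFinset, mem_roots hP] using hroot
  rw [finsum_eq_sum_of_support_subset _ hsupp, Finset.sum_multiset_map_count]
  refine Finset.sum_congr rfl fun u hu => ?_
  rw [Multiset.mem_toFinset, mem_roots hP] at hu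
  have hu1 : u ≠ 1 := by rintro rfl; exact hP1 hu
  have hpos : 0 < ‖(1 : ℂ) - u‖ := norm_pos_iff.2 (sub_ne_zero.2 hu1.symm)
  rw [nsmul_eq_mul, count_roots]
  by_cases hin : ‖1 - u‖ ≤ R
  · rw [hDin u hin, Real.posLog_eq_log]
    · simp
    · rw [abs_of_pos (by positivity), le_mul_inv_iff₀ hpos, one_mul]
      exact hin
  · rw [hDout u hin, (Real.posLog_eq_zero_iff _).2]
    · simp
    · rw [abs_of_pos (by positivity), mul_inv_le_iff₀ hpos, one_mul]
      exact (not_le.1 hin).le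

/-- **Jensen's bound from the angular mean of `log⁺ ‖H‖`.**  For `P ∈ ℂ[z]` with `P(1) ≠ 0`, a
real tilt `a`, `H(z) = P(z) e^{−a(z−1)}/P(1)` and `r > 0`: if `⨍_{‖z−1‖=r} log⁺ ‖H‖ ≤ A` then
`Σ_{ρ ∈ roots P} log⁺ (r/‖1−ρ‖) ≤ A`.  Indeed the left side is `⨍ log ‖H‖` by Jensen's formula
(`H` entire, `H(1) = 1`, zeros of `H` = roots of `P`), and `⨍ log ‖H‖ ≤ ⨍ log⁺ ‖H‖` since
`log ≤ log⁺` pointwise and both integrands are circle integrable. [folklore] -/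
private theorem sum_posLog_le_of_circleAverage {P : ℂ[X]} (hP1 : P.eval 1 ≠ 0) {r : ℝ} (a : ℝ)
    {A : ℝ} (hr : 0 < r)
    (hA : Real.circleAverage (fun z : ℂ => Real.posLog
        ‖P.eval z * Complex.exp (-((a : ℂ) * (z - 1))) / P.eval 1‖) 1 r ≤ A) :
    (P.roots.map fun ρ => Real.posLog (r * ‖1 - ρ‖⁻¹)).sum ≤ A := by
  set H : ℂ → ℂ := fun z => P.eval z * Complex.exp (-((a : ℂ) * (z - 1))) / P.eval 1 with hH
  have hHd : Differentiable ℂ H := by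
    rw [hH]
    fun_prop
  have hH1 : H 1 = 1 := by
    simp [hH, hP1]
  have hord : ∀ u : ℂ, analyticOrderAt H u = P.rootMultiplicity u :=
    analyticOrderAt_tilt_eq_rootMultiplicity hP1 a
  have hJ : Real.circleAverage (fun z => Real.log ‖H z‖) 1 r =
      (P.roots.map fun ρ => Real.posLog (r * ‖1 - ρ‖⁻¹)).sum :=
    circleAverage_log_norm_of_order hP1 hHd hord hH1 hr
  have hHan : AnalyticOnNhd ℂ H (sphere (1 : ℂ) |r|) := fun z _ => hHd.analyticAt z
  have hint1 : CircleIntegrable (fun z => Real.log ‖H z‖) 1 r :=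
    hHan.meromorphicOn.circleIntegrable_log_norm
  have hint2 : CircleIntegrable (fun z => Real.posLog ‖H z‖) 1 r :=
    hHan.meromorphicOn.circleIntegrable_posLog_norm
  have hmono : Real.circleAverage (fun z => Real.log ‖H z‖) 1 r ≤
      Real.circleAverage (fun z => Real.posLog ‖H z‖) 1 r :=
    Real.circleAverage_mono hint1 hint2 fun x _ => by
      rw [Real.posLog_apply]
      exact le_max_right _ _
  have hA' : Real.circleAverage (fun z => Real.posLog ‖H z‖) 1 r ≤ A := hA
  linarith

/-- **Jensen at the free centre ⇒ zero-free disc.**  For `P ∈ ℂ[X]` with `P(1) ≠ 0`, a real tilt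
`a` and `H(z) = P(z)e^{−a(z−1)}/P(1)`: if `⨍_{‖z−1‖=r} log⁺‖H‖ ≤ A` then `P` has no zero in the
open disc `‖z − 1‖ < r e^{−A}` (Jensen's formula for the entire function `H`, `H(1) = 1`: every
root `ρ` of `P` with `‖1−ρ‖ ≤ r` contributes `log(r/‖1−ρ‖) ≤ ⨍ log‖H‖ ≤ ⨍ log⁺‖H‖ ≤ A`).
[Titchmarsh, Theory of Functions §3.61] -/
theorem stub_zeroFree :
    ∀ (P : Polynomial ℂ) (r a A : ℝ), 0 < r → 0 ≤ A → P.eval 1 ≠ 0 →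
      Real.circleAverage (fun z : ℂ => Real.posLog
        ‖P.eval z * Complex.exp (-((a : ℂ) * (z - 1))) / P.eval 1‖) 1 r ≤ A →
      ∀ z : ℂ, ‖z - 1‖ < r * Real.exp (-A) → P.eval z ≠ 0 := by
  intro P r a A hr _hA hP1 hA z hz hPz
  have hP : P ≠ 0 := fun h => hP1 (by simp [h])
  -- Jensen at the free centre: `Σ_ρ log⁺(r/‖1−ρ‖) ≤ A`
  have hsum : (P.roots.map fun ρ => Real.posLog (r * ‖1 - ρ‖⁻¹)).sum ≤ A :=
    sum_posLog_le_of_circleAverage hP1 a hr hA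
  -- single out the root `z`
  have hzroot : z ∈ P.roots := (mem_roots hP).2 hPz
  have hz1 : z ≠ 1 := by rintro rfl; exact hP1 hPz
  have hd : 0 < ‖(1 : ℂ) - z‖ := norm_pos_iff.2 (sub_ne_zero.2 hz1.symm)
  have hterm : Real.posLog (r * ‖(1 : ℂ) - z‖⁻¹) ≤
      (P.roots.map fun ρ => Real.posLog (r * ‖1 - ρ‖⁻¹)).sum :=
    Multiset.single_le_sum (fun x hx => by
      rw [Multiset.mem_map] at hx
      obtain ⟨σ, _, rfl⟩ := hx
      exact Real.posLog_nonneg) _ (Multiset.mem_map_of_mem _ hzroot)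
  have hlog : Real.log (r * ‖(1 : ℂ) - z‖⁻¹) ≤ A := by
    have h := le_max_right 0 (Real.log (r * ‖(1 : ℂ) - z‖⁻¹))
    rw [← Real.posLog_apply] at h
    linarith
  -- hence `r/‖1 − z‖ ≤ e^{A}`, i.e. `‖z − 1‖ ≥ r e^{−A}`
  have hq : r * ‖(1 : ℂ) - z‖⁻¹ ≤ Real.exp A := by
    have hpos : 0 < r * ‖(1 : ℂ) - z‖⁻¹ := by positivity
    calc r * ‖(1 : ℂ) - z‖⁻¹ = Real.exp (Real.log (r * ‖(1 : ℂ) - z‖⁻¹)) :=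
          (Real.exp_log hpos).symm
      _ ≤ Real.exp A := Real.exp_le_exp.2 hlog
  rw [mul_inv_le_iff₀ hd] at hq
  have hE : 0 < Real.exp (-A) := Real.exp_pos _
  have hEE : Real.exp A * Real.exp (-A) = 1 := by
    rw [← Real.exp_add, add_neg_cancel, Real.exp_zero]
  have hle : r * Real.exp (-A) ≤ ‖z - 1‖ := by
    rw [norm_sub_rev]
    calc r * Real.exp (-A) ≤ Real.exp A * ‖(1 : ℂ) - z‖ * Real.exp (-A) :=
          mul_le_mul_of_nonneg_right hq hE.le
      _ = ‖(1 : ℂ) - z‖ := by rw [mul_right_comm, hEE, one_mul]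
  linarith

end Summit.Parity.BatemanHorn.Cruxes.SystemMomentDeficit.SmallCircle

end
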